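import Summits.HodgeConjecture.HodgeConjecture.Theorems.PeriodDeficiencyQbarGenericIsHodgeGenericStubConjIrredClosed
import HarnessLib

/-!
# The fibre of a `ℚ̄`-family over a conjugate point is the conjugate variety of the fibre

Helper for the crux `QbarGenericIsHodgeGeneric` (stmt-HodgeConjecture-11595), line `registered`,
reshape r4, stub (ii-a). Let `σ : K →+* ℂ` be an embedding of a field, `f₀ : 𝒳₀ ⟶ S₀` a
morphism of `K`-schemes, `f = f₀ ⊗_σ ℂ : 𝒳 ⟶ S` its complexification (`Motives.baseChangeHom σ`),
`τ ∈ Aut(ℂ/σK)` and `y ∈ S(ℂ)`. Then the fibre `𝒳_{τ·y}` of `f` over the conjugate point `τ · y`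
(`HodgeTheory.conjPoint`) is isomorphic, as a `ℂ`-scheme, to the conjugate variety
`(𝒳_y)^τ = 𝒳_y ×_{Spec ℂ, Spec τ} Spec ℂ` (`Motives.conjugateVariety`, Deligne's convention) of
the fibre over `y` (Lang, *Introduction to Algebraic Geometry*, III §4: "`A^σ` consists of the
points `(x^σ)`"; Deligne 1982, §1).

Proof. Write `S = S₀ ×_K Spec ℂ`, `𝒳 = 𝒳₀ ×_K Spec ℂ`, `F = f₀ ×_K Spec ℂ`, and let
`ψ_ρ = 𝟙 ×_K Spec ρ` be the Galois twist of `T ×_K Spec ℂ` for `ρ ∈ Aut(ℂ/σK)`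
(`exists_galoisTwist_iso`: an automorphism with inverse `ψ_{ρ⁻¹}`, natural in `T`, so
`ψ_ρ ≫ F = F ≫ ψ_ρ`, `galoisTwist_naturality`). On underlying morphisms
`(τ · y) = Spec τ ≫ y ≫ ψ_{τ⁻¹}` (both sides have the same two projections). Hence
`𝒳 ×_{S, τ·y} Spec ℂ = 𝒳 ×_{S, (Spec τ ≫ y) ≫ ψ_τ⁻¹} Spec ℂ ≅ 𝒳 ×_{S, Spec τ ≫ y} Spec ℂ`
(transport of the cartesian square along the automorphisms `ψ_τ` of `𝒳` and `S`, Mathlib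
`pullback.map` of isomorphisms) `≅ (𝒳 ×_{S, y} Spec ℂ) ×_{Spec ℂ, Spec τ} Spec ℂ` (pasting of
pullbacks, Mathlib `pullbackLeftPullbackSndIso`) — `exists_pullback_comp_inv_iso` — and every
step commutes with the second projections to `Spec ℂ`, which are the structure maps
(`Motives.fiberOver_hom`).

The last declaration `stub_fiberOver_conjPoint_iso` is the registered stub (ii-a) of the crux
skeleton `Cruxes/QbarGenericIsHodgeGeneric/Lines/birth.lean` (reshape r4), verbatim.

## References
* [Lang1958IAG] S. Lang, *Introduction to Algebraic Geometry* (1958), Ch. III §4.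
* [Deligne1982] P. Deligne, *Hodge cycles on abelian varieties*, LNM 900 (1982), §1.
-/

-- every declaration of this problem lives in `Summit.HodgeConjecture.HodgeConjecture.…`
set_option linter.dupNamespace false

noncomputable section

namespace Summit.HodgeConjecture.HodgeConjecture.Theorems

open CategoryTheory CategoryTheory.Limits AlgebraicGeometry
open Literature.AlgebraicGeometry.Motives Literature.AlgebraicGeometry.HodgeTheory

universe v u

/-! ### Transport of a fibre along compatible automorphisms, and pasting -/

/-- **Transport and pasting of fibres.** In a category with pullbacks, let `F : P ⟶ Q`, let
`Ψ`, `ψ` be automorphisms of `P`, `Q` with `Ψ ≫ F = F ≫ ψ`, and let `g : R ⟶ Q`, `t : R' ⟶ R`.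
Then `P ×_{Q, (t ≫ g) ≫ ψ⁻¹} R' ≅ (P ×_{Q, g} R) ×_{R, t} R'`, compatibly with the second
projections to `R'`: the cartesian square over `(t ≫ g) ≫ ψ⁻¹` is carried to the one over `t ≫ g`
by `(Ψ, 𝟙, ψ)` (Mathlib `pullback.map`, an isomorphism), and the latter is the pasting of the
squares over `g` and `t` (Mathlib `pullbackLeftPullbackSndIso`). [folklore] -/
theorem exists_pullback_comp_inv_iso {C : Type u} [Category.{v} C] [HasPullbacks C]
    {P Q R R' : C} (F : P ⟶ Q) (Ψ : P ≅ P) (ψ : Q ≅ Q) (hnat : Ψ.hom ≫ F = F ≫ ψ.hom)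
    (g : R ⟶ Q) (t : R' ⟶ R) :
    ∃ e : pullback F ((t ≫ g) ≫ ψ.inv) ≅ pullback (pullback.snd F g) t,
      e.hom ≫ pullback.snd _ _ = pullback.snd _ _ := by
  refine ⟨asIso (pullback.map F ((t ≫ g) ≫ ψ.inv) F (t ≫ g) Ψ.hom (𝟙 _) ψ.hom hnat.symm
      (by rw [Category.assoc, Iso.inv_hom_id, Category.comp_id, Category.id_comp])) ≪≫
    (pullbackLeftPullbackSndIso F g t).symm, ?_⟩
  simp only [Iso.trans_hom, asIso_hom, Iso.symm_hom, Category.assoc,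
    pullbackLeftPullbackSndIso_inv_snd_snd, pullback.lift_snd, Category.comp_id]

/-! ### The Galois twist `𝟙 ×_K Spec ρ` of `T ×_K Spec ℂ` -/

section GaloisTwist

variable {K : Type} [Field K] (σ : K →+* ℂ)

/-- If `ρ ∈ Aut(ℂ)` fixes `σ(K)` pointwise (`ρ ∘ σ = σ`), so does `ρ⁻¹`. [folklore] -/
theorem symm_toRingHom_comp_eq {ρ : ℂ ≃+* ℂ} (hρ : ρ.toRingHom.comp σ = σ) :
    ρ.symm.toRingHom.comp σ = σ := by
  ext a
  have h := congrArg ρ.symm (RingHom.congr_fun hρ a)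
  simp only [RingHom.coe_comp, RingEquiv.toRingHom_eq_coe, RingEquiv.coe_toRingHom,
    Function.comp_apply, RingEquiv.symm_apply_apply] at h
  simpa using h.symm

/-- An automorphism of `ℂ` over `σ(K)` (`HodgeTheory.ringAutOver`), as a ring automorphism,
fixes `σ`: `τ ∘ σ = σ`. [folklore] -/
theorem ringAutOver_toRingHom_comp (τ : ringAutOver σ) :
    (letI := σ.toAlgebra; (τ : ℂ ≃+* ℂ)).toRingHom.comp σ = σ := by
  letI := σ.toAlgebra
  ext a
  exact τ.commutes a

variable (T : SchemeOver K)

/-- **The Galois twist `𝟙 ×_K Spec ρ` of `T ×_K Spec ℂ` exists** for `ρ ∈ Aut(ℂ)` with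
`ρ ∘ σ = σ`: an endomorphism of the fibre product `T ×_{Spec K, Spec σ} Spec ℂ` which is the
identity on the first factor and covers `Spec ρ` on the second (Mathlib `pullback.map`; Lang III §4,
the shape consumed by `HodgeTheory.pt_conjPoint_eq`). [cite: Lang1958IAG, Ch. III §4] -/
theorem exists_galoisTwistMap (ρ : ℂ ≃+* ℂ) (hρ : ρ.toRingHom.comp σ = σ) :
    ∃ ψ : pullback T.hom (Spec.map (CommRingCat.ofHom σ)) ⟶
        pullback T.hom (Spec.map (CommRingCat.ofHom σ)),
      ψ ≫ pullback.fst _ _ = pullback.fst _ _ ∧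
        ψ ≫ pullback.snd _ _ = pullback.snd _ _ ≫ Spec.map (CommRingCat.ofHom ρ.toRingHom) :=
  ⟨pullback.map _ _ _ _ (𝟙 _) (Spec.map (CommRingCat.ofHom ρ.toRingHom)) (𝟙 _)
      (by rw [Category.comp_id, Category.id_comp])
      (by rw [Category.comp_id, ← Spec.map_comp, ← CommRingCat.ofHom_comp, hρ]),
    (pullback.lift_fst _ _ _).trans (Category.comp_id _), pullback.lift_snd _ _ _⟩

/-- Endomorphisms of `T ×_K Spec ℂ` over `T` covering `Spec ρ₁`, `Spec ρ₂` with `ρ₁ ∘ ρ₂ = id`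
compose to the identity (compare the two projections). [folklore] -/
theorem galoisTwistMap_comp_eq_id {ρ₁ ρ₂ : ℂ ≃+* ℂ}
    {ψ₁ ψ₂ : pullback T.hom (Spec.map (CommRingCat.ofHom σ)) ⟶
      pullback T.hom (Spec.map (CommRingCat.ofHom σ))}
    (h₁f : ψ₁ ≫ pullback.fst _ _ = pullback.fst _ _)
    (h₁s : ψ₁ ≫ pullback.snd _ _ = pullback.snd _ _ ≫ Spec.map (CommRingCat.ofHom ρ₁.toRingHom))
    (h₂f : ψ₂ ≫ pullback.fst _ _ = pullback.fst _ _)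
    (h₂s : ψ₂ ≫ pullback.snd _ _ = pullback.snd _ _ ≫ Spec.map (CommRingCat.ofHom ρ₂.toRingHom))
    (h₁₂ : ρ₁.toRingHom.comp ρ₂.toRingHom = RingHom.id ℂ) :
    ψ₁ ≫ ψ₂ = 𝟙 _ := by
  apply pullback.hom_ext
  · rw [Category.assoc, h₂f, h₁f, Category.id_comp]
  · rw [Category.assoc, h₂s, reassoc_of% h₁s, Category.id_comp, ← Spec.map_comp,
      ← CommRingCat.ofHom_comp, h₁₂, CommRingCat.ofHom_id, Spec.map_id, Category.comp_id]

/-- **The Galois twist is an automorphism.** For `ρ ∈ Aut(ℂ)` with `ρ ∘ σ = σ` there is an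
automorphism `ψ_ρ` of `T ×_K Spec ℂ` over `T` covering `Spec ρ` on the second factor, whose
inverse is over `T` and covers `Spec ρ⁻¹` (the twists by `ρ` and `ρ⁻¹`; Lang III §4).
[cite: Lang1958IAG, Ch. III §4] -/
theorem exists_galoisTwist_iso (ρ : ℂ ≃+* ℂ) (hρ : ρ.toRingHom.comp σ = σ) :
    ∃ ψ : pullback T.hom (Spec.map (CommRingCat.ofHom σ)) ≅
        pullback T.hom (Spec.map (CommRingCat.ofHom σ)),
      (ψ.hom ≫ pullback.fst _ _ = pullback.fst _ _ ∧
        ψ.hom ≫ pullback.snd _ _ =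
          pullback.snd _ _ ≫ Spec.map (CommRingCat.ofHom ρ.toRingHom)) ∧
      (ψ.inv ≫ pullback.fst _ _ = pullback.fst _ _ ∧
        ψ.inv ≫ pullback.snd _ _ =
          pullback.snd _ _ ≫ Spec.map (CommRingCat.ofHom ρ.symm.toRingHom)) := by
  obtain ⟨ψ₁, h₁f, h₁s⟩ := exists_galoisTwistMap σ T ρ hρ
  obtain ⟨ψ₂, h₂f, h₂s⟩ := exists_galoisTwistMap σ T ρ.symm (symm_toRingHom_comp_eq σ hρ)
  exact ⟨⟨ψ₁, ψ₂, galoisTwistMap_comp_eq_id σ T h₁f h₁s h₂f h₂s ρ.toRingHom_comp_symm_toRingHom,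
      galoisTwistMap_comp_eq_id σ T h₂f h₂s h₁f h₁s ρ.symm_toRingHom_comp_toRingHom⟩,
    ⟨h₁f, h₁s⟩, ⟨h₂f, h₂s⟩⟩

/-- **Naturality of the Galois twist.** If `F : 𝒳₀ ×_K Spec ℂ ⟶ S₀ ×_K Spec ℂ` covers
`f₀ : 𝒳₀ ⟶ S₀` on the first factors and the identity on the second (e.g. `F = f₀ ×_K Spec ℂ`),
and `ψ_𝒳`, `ψ_S` are endomorphisms over `𝒳₀`, `S₀` covering the same `t : Spec ℂ ⟶ Spec ℂ`, then
`ψ_𝒳 ≫ F = F ≫ ψ_S` (compare the two projections). [folklore] -/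
theorem galoisTwist_naturality {𝒳₀ S₀ : SchemeOver K} (f₀ : 𝒳₀ ⟶ S₀)
    {F : pullback 𝒳₀.hom (Spec.map (CommRingCat.ofHom σ)) ⟶
      pullback S₀.hom (Spec.map (CommRingCat.ofHom σ))}
    (hF₁ : F ≫ pullback.fst _ _ = pullback.fst _ _ ≫ f₀.left)
    (hF₂ : F ≫ pullback.snd _ _ = pullback.snd _ _)
    {ψX : pullback 𝒳₀.hom (Spec.map (CommRingCat.ofHom σ)) ⟶
      pullback 𝒳₀.hom (Spec.map (CommRingCat.ofHom σ))}
    {ψS : pullback S₀.hom (Spec.map (CommRingCat.ofHom σ)) ⟶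
      pullback S₀.hom (Spec.map (CommRingCat.ofHom σ))}
    {t : Spec (.of ℂ) ⟶ Spec (.of ℂ)}
    (hX₁ : ψX ≫ pullback.fst _ _ = pullback.fst _ _) (hX₂ : ψX ≫ pullback.snd _ _ = pullback.snd _ _ ≫ t)
    (hS₁ : ψS ≫ pullback.fst _ _ = pullback.fst _ _) (hS₂ : ψS ≫ pullback.snd _ _ = pullback.snd _ _ ≫ t) :
    ψX ≫ F = F ≫ ψS := by
  apply pullback.hom_ext
  · rw [Category.assoc, Category.assoc, hF₁, hS₁, reassoc_of% hX₁, hF₁]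
  · rw [Category.assoc, Category.assoc, hF₂, hS₂, hX₂, reassoc_of% hF₂]

end GaloisTwist

/-- **Registered stub `stub_fiberOver_conjPoint_iso` of the crux skeleton
`QbarGenericIsHodgeGeneric` (line `registered`, reshape r4, stub (ii-a)) — the fibre of a
`ℚ̄`-family over a conjugate point is the conjugate variety of the fibre**: for
`f = f₀ ⊗_σ ℂ : 𝒳 ⟶ S`, `τ ∈ Aut(ℂ/ℚ̄)` and `y ∈ S(ℂ)` there is an isomorphism of `ℂ`-schemes
`𝒳_{τ·y} ≅ (𝒳_y)^τ = 𝒳_y ×_{Spec ℂ, Spec τ} Spec ℂ` (`Motives.conjugateVariety`, Deligne's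
convention: `X^τ` is cut out by the `τ`-conjugates of the equations of `X`). Proof: on underlying
morphisms `(τ · y) = Spec τ ≫ y ≫ ψ_τ⁻¹` for the Galois twist `ψ_τ = 𝟙 ×_ℚ̄ Spec τ` of `S₀ ⊗ ℂ`
(`exists_galoisTwist_iso`; `τ · —` is `Spec τ ≫ —` on `S₀(ℂ)`, `Motives.AlgPoints.smul_left`),
the twists of `𝒳₀ ⊗ ℂ` and `S₀ ⊗ ℂ` commute with `f` (`galoisTwist_naturality`), whence the
scheme isomorphism `exists_pullback_comp_inv_iso`; both structure maps are the second
projections to `Spec ℂ` (`Motives.fiberOver_hom`). [cite: Lang1958IAG, Ch. III §4] [cite: Deligne1982, §1] -/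
theorem stub_fiberOver_conjPoint_iso :
    ∀ (σ : AlgebraicClosure ℚ →+* ℂ) ⦃𝒳₀ S₀ : SchemeOver (AlgebraicClosure ℚ)⦄ (f₀ : 𝒳₀ ⟶ S₀)
      (τ : ringAutOver σ) (y : ComplexPoints ((baseChangeHom σ).obj S₀)),
      Nonempty (fiberOver ((baseChangeHom σ).map f₀) (conjPoint σ S₀ τ y) ≅
        conjugateVariety (letI := σ.toAlgebra; AlgEquiv.toRingEquiv τ) (fiberOver ((baseChangeHom σ).map f₀) y)) := by
  intro σ 𝒳₀ S₀ f₀ τ y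
  letI := σ.toAlgebra
  have hτ : (τ : ℂ ≃+* ℂ).toRingHom.comp σ = σ := ringAutOver_toRingHom_comp σ τ
  -- the underlying morphisms of `f = f₀ ⊗_σ ℂ`, `y` and `τ · y`, with their types spelled as
  -- fibre products
  set F : pullback 𝒳₀.hom (Spec.map (CommRingCat.ofHom σ)) ⟶
      pullback S₀.hom (Spec.map (CommRingCat.ofHom σ)) := ((baseChangeHom σ).map f₀).left with hF
  have hF₁ : F ≫ pullback.fst _ _ = pullback.fst _ _ ≫ f₀.left := pullback.lift_fst _ _ _
  have hF₂ : F ≫ pullback.snd _ _ = pullback.snd _ _ := pullback.lift_snd _ _ _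
  set yl : Spec (.of ℂ) ⟶ pullback S₀.hom (Spec.map (CommRingCat.ofHom σ)) := y.left with hyl
  set cl : Spec (.of ℂ) ⟶ pullback S₀.hom (Spec.map (CommRingCat.ofHom σ)) :=
    (conjPoint σ S₀ τ y).left with hcl
  have hspec : Spec.map (CommRingCat.ofHom (algebraMap ℂ ℂ)) = 𝟙 (Spec (.of ℂ)) := by
    rw [Algebra.algebraMap_self, CommRingCat.ofHom_id, Spec.map_id]
  have hy₂ : yl ≫ pullback.snd _ _ = 𝟙 _ := (Over.w y).trans hspec
  have hc₂ : cl ≫ pullback.snd _ _ = 𝟙 _ := (Over.w (conjPoint σ S₀ τ y)).trans hspec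
  -- the Galois twists `ψ_τ` of `𝒳₀ ⊗ ℂ` and `S₀ ⊗ ℂ` (inverses: the twists by `τ⁻¹`)
  obtain ⟨ψX, ⟨hX₁, hX₂⟩, -⟩ := exists_galoisTwist_iso σ 𝒳₀ (τ : ℂ ≃+* ℂ) hτ
  obtain ⟨ψS, ⟨hS₁, hS₂⟩, ⟨hS₃, hS₄⟩⟩ := exists_galoisTwist_iso σ S₀ (τ : ℂ ≃+* ℂ) hτ
  have hnat : ψX.hom ≫ F = F ≫ ψS.hom := galoisTwist_naturality σ f₀ hF₁ hF₂ hX₁ hX₂ hS₁ hS₂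
  -- the conjugate point as a morphism: `(τ · y) = Spec τ ≫ y ≫ ψ_τ⁻¹` (compare projections)
  have hc : cl = (Spec.map (CommRingCat.ofHom (τ : ℂ ≃+* ℂ).toRingHom) ≫ yl) ≫ ψS.inv := by
    have hc₁ : cl ≫ pullback.fst _ _ =
        Spec.map (CommRingCat.ofHom (τ : ℂ →+* ℂ)) ≫ yl ≫ pullback.fst _ _ := by
      have e₁ := AlgPoints.baseChangeEquiv_apply_left_comp_fst σ S₀
        (τ • (AlgPoints.baseChangeEquiv σ S₀).symm y)
      rw [AlgPoints.smul_left, AlgPoints.baseChangeEquiv_symm_apply_left] at e₁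
      exact e₁
    apply pullback.hom_ext
    · rw [hc₁, Category.assoc, Category.assoc, hS₃]
      rfl
    · rw [hc₂, Category.assoc, Category.assoc, hS₄, reassoc_of% hy₂, ← Spec.map_comp,
        ← CommRingCat.ofHom_comp, RingEquiv.toRingHom_comp_symm_toRingHom, CommRingCat.ofHom_id,
        Spec.map_id]
  -- the isomorphism of underlying schemes, compatible with the second projections
  obtain ⟨e, he⟩ := exists_pullback_comp_inv_iso F ψX ψS hnat yl
    (Spec.map (CommRingCat.ofHom (τ : ℂ ≃+* ℂ).toRingHom))
  -- the structure map `𝒳_y ⟶ 𝒳 ⟶ Spec ℂ` of the fibre over `y` is the second projection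
  have hy : pullback.snd F yl = (fiberOver ((baseChangeHom σ).map f₀) y).hom := by
    show pullback.snd F yl = pullback.fst F yl ≫ pullback.snd 𝒳₀.hom (Spec.map (CommRingCat.ofHom σ))
    rw [← hF₂, pullback.condition_assoc, hy₂, Category.comp_id]
  refine ⟨Over.isoMk (pullback.congrHom rfl hc ≪≫ e ≪≫ pullback.congrHom hy rfl) ?_⟩
  -- compatibility with the structure maps: both are the second projections to `Spec ℂ`
  show (pullback.congrHom rfl hc ≪≫ e ≪≫ pullback.congrHom hy rfl).hom ≫ pullback.snd _ _ =
    pullback.fst F cl ≫ pullback.snd 𝒳₀.hom (Spec.map (CommRingCat.ofHom σ))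
  rw [← hF₂, pullback.condition_assoc, hc₂, Category.comp_id]
  simp only [Iso.trans_hom, Category.assoc, pullback.congrHom_hom, pullback.lift_snd,
    Category.comp_id]
  rw [he, pullback.lift_snd, Category.comp_id]

end Summit.HodgeConjecture.HodgeConjecture.Theorems

end
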